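/-
Copyright (c) 2026 the pub-hodgecm-mathlib formalisation cell (harness21).  Prover seat hodgecm-mathlib-F0P2-p02 (g14): road «S3-ram» (LEAD F0P3a-plan (g13);
owner F0P3a-p06 (g15); (Cnt2′) chair F0P3a-p07 (g14) ruling (3), 2026-09-02T02:14:32Z), organ (z3) «CONE TRANSPORT», generic graph half (b); 2026-09-02.
-/
import Literature.Combinatorics.SimpleGraph.TreeDescendantPartition   -- ★ G1 (F0P2-p02 (g13)): cones in `(h, p)` currency, geodesic shadow, `exists_rooted_parent`; ⊇ ★ `TreeRetractionGate`
import HarnessLib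

/-!
# The cone of a vertex toward a subtree is the rooted shadow from its gate: `Cone_Y(c) = {w | dist(y, w) = dist(y, c) + dist(c, w)}`, `y` the projection of `c`
# (Serre, *Trees* I.2.3)

Topic `Combinatorics/SimpleGraph`; namespace `Literature.Combinatorics.SimpleGraph.TreeLayers` (family of ★ `TreeRetractionGate` ∕ ★ `TreeDescendantPartition`).
THEOREMS ONLY (no definition, no instance, no notation, no named fact, no `sorry`); Mathlib + ★ `TreeDescendantPartition`; arbitrary vertex type.  Cell
`pub/hodgecm-mathlib`, F0∕P3a, crux H413 = `stmt-HodgeConjecture-24833`, road «S3-ram» (Literature seeding, count-neutral): organ **(z3) «CONE TRANSPORT», generic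
graph half (b)** of the (Cnt2′) type-(2) assembly (chair F0P3a-p07 (g14), ruling (3) 2026-09-02T02:14:32Z) — the bridge between the TWO cone currencies in the tree:
the cones TOWARD A SUBTREE `Y` (the axis of a type-(2) literal; retraction data `(h, p)` of ★ `TreeRetraction.exists_retraction`, cones `{w | h c ≤ h w ∧ p^[h w − h c] w = c}`,
partition∕equivariance ★ `TreeRetractionGate` §3) and the cones of a ROOTED tree (`{w | dist(r, w) = dist(r, v) + dist(v, w)}`, the currency of the ★ engines
`strataVec_cone_eq_of_localLaw` ∕ `…_offRegion` ∕ `…_of_rootRegion`).  HONEST LABEL: HC_CM is proved only modulo the 2 remaining named inputs (hLiu418 24832,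
h413 24833) until rung 0 closes; pure graph theory here.

THE MATHEMATICS ([Serre1980Trees] I.2.3).  `G` a tree, `Y ⊆ V`, `(h, p)` height∕parent data toward `Y` through the clauses (P1) `h v = 0 ↔ v ∈ Y`, (P2) `v ∉ Y ⇒ v ~ p v ∧
h (p v) + 1 = h v`, (P5) `v ∉ Y ⇒` every neighbour `w ≠ p v` has `h w = h v + 1 ∧ p w = v`, (dist) `h v = dist(v, Y)` (attained) — taken as HYPOTHESES, as in the sibling
files; the ROOT (gate, projection) of `v` is `p^[h v] v ∈ Y`.  For `c ∉ Y` with root `y`: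
* §1 `iterate_parent_height_eq_of_mem_cone` (a descendant of `c` has the same root), `dist_root_eq_height_of_mem_cone` (`dist(y, w) = h w` on the cone of `c`),
  **`dist_root_eq_add_of_mem_cone`** (`w ∈ Cone_Y(c) ⇒ dist(y, w) = dist(y, c) + dist(c, w)`: the cone lies in the rooted shadow of `c` from its gate);
* §2 **`mem_cone_of_dist_root_eq_add`** — the converse (`G` a tree): a vertex in the rooted shadow of `c` from `y` descends from `c` (induction along the rooted parent
  map of ★ `exists_rooted_parent` at `y`: the rooted parent of a shadow vertex is never the `Y`-parent of its image, by the gate distances, so (P5) applies);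
* §3 **`cone_eq_setOf_dist_root`** — `{w | h c ≤ h w ∧ p^[h w − h c] w = c} = {w | dist(y, w) = dist(y, c) + dist(c, w)}`, with the `∩ S` ∕ `ncard` spellings
  (`cone_inter_eq_setOf_dist_root_inter`, `ncard_cone_inter_eq_ncard_setOf_dist_root_inter`) and the CHILDREN dictionary `height_eq_succ_iff_dist_root_eq_succ_of_mem_cone`
  (for a neighbour `c'` of a cone vertex `v`: `h c' = h v + 1 ↔ dist(y, c') = dist(y, v) + 1`) — so a rooted-tree statement about the shadow of `c` from the root `y`
  (e.g. the ★ tree induction OFF a root region, `R :=` the complement of the shadow) IS a statement about the cone of `c` toward `Y`;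
* §4 **`ncard_eq_sum_ncard_cone_inter`** ∕ `ncard_inter_eq_sum_ncard_cone_inter` — COUNTING CONE BY CONE: for a finite `S` and a Finset `sY` containing the roots of its
  elements, `#S = Σ_{y ∈ sY} #({w | p^[h w] w = y} ∩ S)` (the fixed set of a type-(2) literal, counted axis vertex by axis vertex);
* §5 (ED. 2) ANY VERTEX OF THE SUBTREE AS ROOT: `dist_parent_succ_of_mem`, `dist_eq_add_of_mem_cone_of_mem`, `mem_cone_of_dist_eq_add_of_mem`,
  **`cone_eq_setOf_dist_of_mem`** (`Cone_Y(c) = {w | dist(y′, w) = dist(y′, c) + dist(c, w)}` for EVERY `y′ ∈ Y`), `ncard_cone_inter_eq_ncard_setOf_dist_inter_of_mem`,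
  `height_eq_succ_iff_dist_eq_succ_of_mem` ∕ `eq_parent_iff_dist_succ_eq_of_mem` (children ∕ parent dictionaries below the subtree) — so the whole tube is read in the
  tree rooted ONCE at any fixed axis vertex.

## References
* [Serre1980Trees] J.-P. Serre, *Trees*, Springer (1980): I.2.3 (projection onto a subtree; every geodesic into the subtree passes through the projection), I.6.4 Prop. 24.
* [Diestel2010] R. Diestel, *Graph Theory*, 4th ed., Thm. 1.5.1 (unique paths in trees).
-/

set_option autoImplicit false

open SimpleGraph

namespace Literature.Combinatorics.SimpleGraph.TreeLayers

variable {V : Type*} {G : SimpleGraph V}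

section ConeShadow

variable {Y : Set V} {h : V → ℕ} {p : V → V}
  (h0 : ∀ v, h v = 0 ↔ v ∈ Y) (hpar : ∀ v, v ∉ Y → G.Adj v (p v) ∧ h (p v) + 1 = h v)
  (hchild : ∀ v w, v ∉ Y → G.Adj v w → w ≠ p v → h w = h v + 1 ∧ p w = v)

/-! ## §1 The cone of `c` lies in the rooted shadow of `c` from its gate -/

/-- A descendant of `c` has the same root as `c`: `p^[h w] w = p^[h c] c` for `w ∈ Cone_Y(c)`. [cite: Serre1980Trees, I.2.3] -/
theorem iterate_parent_height_eq_of_mem_cone {c w : V} (hw : w ∈ {w | h c ≤ h w ∧ p^[h w - h c] w = c}) : p^[h w] w = p^[h c] c := by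
  obtain ⟨hcw, hwc⟩ := hw
  have heq : h w = h c + (h w - h c) := by omega
  rw [heq, Function.iterate_add_apply, hwc]

include h0 hpar in
/-- On the cone of `c`, the distance to the root `y` of `c` is the height: `dist(y, w) = h w`. [cite: Serre1980Trees, I.2.3] -/
theorem dist_root_eq_height_of_mem_cone (hdist : ∀ v, (∃ y ∈ Y, G.dist v y = h v) ∧ ∀ y ∈ Y, h v ≤ G.dist v y)
    {c w y : V} (hy : p^[h c] c = y) (hw : w ∈ {w | h c ≤ h w ∧ p^[h w - h c] w = c}) : G.dist y w = h w := by
  rw [← hy, ← iterate_parent_height_eq_of_mem_cone hw, SimpleGraph.dist_comm]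
  exact dist_iterate_parent_height_eq h0 hpar hdist w

include h0 hpar in
/-- **The cone lies in the rooted shadow**: for `w ∈ Cone_Y(c)` and `y` the root of `c`, `dist(y, w) = dist(y, c) + dist(c, w)` (`G` connected).
[cite: Serre1980Trees, I.2.3] -/
theorem dist_root_eq_add_of_mem_cone (hc : G.Connected) (hdist : ∀ v, (∃ y ∈ Y, G.dist v y = h v) ∧ ∀ y ∈ Y, h v ≤ G.dist v y)
    {c w y : V} (hy : p^[h c] c = y) (hw : w ∈ {w | h c ≤ h w ∧ p^[h w - h c] w = c}) : G.dist y w = G.dist y c + G.dist c w := by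
  have h1 : h w = h c + G.dist c w := height_eq_add_dist_of_mem_cone h0 hpar hc hdist hw
  rw [dist_root_eq_height_of_mem_cone h0 hpar hdist hy hw, dist_root_eq_height_of_mem_cone h0 hpar hdist hy (mem_cone_self c), h1]

include h0 hpar in
/-- The `Y`-parent of a vertex `u ∉ Y` is one step CLOSER to the root `y` of `u`: `dist(y, p u) + 1 = dist(y, u)`. [cite: Serre1980Trees, I.2.3] -/
theorem dist_root_parent_succ (hdist : ∀ v, (∃ y ∈ Y, G.dist v y = h v) ∧ ∀ y ∈ Y, h v ≤ G.dist v y)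
    {u y : V} (hu : u ∉ Y) (hy : p^[h u] u = y) : G.dist y (p u) + 1 = G.dist y u := by
  have hpu : p^[h (p u)] (p u) = y := by rw [iterate_parent_height_parent hpar hu, hy]
  have h1 : G.dist y (p u) = h (p u) := by
    rw [← hpu, SimpleGraph.dist_comm]; exact dist_iterate_parent_height_eq h0 hpar hdist (p u)
  have h2 : G.dist y u = h u := by
    rw [← hy, SimpleGraph.dist_comm]; exact dist_iterate_parent_height_eq h0 hpar hdist u
  rw [h1, h2]
  exact (hpar u hu).2

/-! ## §2 The converse in a tree: the rooted shadow of `c` from its gate consists of descendants of `c` -/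

include h0 hpar hchild in
/-- **The rooted shadow from the gate consists of descendants**: in a tree, for `c ∉ Y` with root `y = p^[h c] c`, every `w` with `dist(y, w) = dist(y, c) + dist(c, w)`
lies in the cone of `c` toward `Y`.  Induction along the rooted parent map `p'` at `y` (★ `exists_rooted_parent`): if `p' w` descends from `c` then `w` is a neighbour of
the cone vertex `u := p' w` other than its `Y`-parent (`dist(y, p u) = dist(y, u) − 1` while `dist(y, w) = dist(y, u) + 1`), hence a child of `u` by (P5).
[cite: Serre1980Trees, I.2.3] [cite: Diestel2010, Thm. 1.5.1] -/
theorem mem_cone_of_dist_root_eq_add (hT : G.IsTree) (hdist : ∀ v, (∃ y ∈ Y, G.dist v y = h v) ∧ ∀ y ∈ Y, h v ≤ G.dist v y)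
    {c y : V} (hcY : c ∉ Y) (hy : p^[h c] c = y) {w : V} (hw : G.dist y w = G.dist y c + G.dist c w) :
    w ∈ {w | h c ≤ h w ∧ p^[h w - h c] w = c} := by
  obtain ⟨p', hp'par, -, -, hp'cone⟩ := exists_rooted_parent hT y
  -- `dist(y, c) = h c ≥ 1`
  have hyc : G.dist y c = h c := dist_root_eq_height_of_mem_cone h0 hpar hdist hy (mem_cone_self c)
  have hc1 : 1 ≤ h c := by
    rcases Nat.eq_zero_or_pos (h c) with h0c | hpos
    · exact absurd ((h0 c).1 h0c) hcY
    · exact hpos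
  -- induction on the number of rooted steps from `w` down to `c`
  suffices key : ∀ (k : ℕ) (w : V), G.dist y c ≤ G.dist y w → p'^[k] w = c → G.dist y w - G.dist y c = k →
      w ∈ {w | h c ≤ h w ∧ p^[h w - h c] w = c} by
    obtain ⟨hle, hit⟩ := (hp'cone c w).1 hw
    exact key _ w hle hit rfl
  intro k
  induction k with
  | zero =>
    intro w _ hit _
    rw [Function.iterate_zero_apply] at hit
    rw [hit]
    exact mem_cone_self c
  | succ k ih =>
    intro w hle hit hk
    have hwy : w ≠ y := by
      rintro rfl
      rw [SimpleGraph.dist_self] at hk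
      omega
    obtain ⟨hadj, hdp⟩ := hp'par w hwy
    rw [Function.iterate_succ_apply] at hit
    -- the rooted parent `u := p' w` descends from `c`
    have hu : p' w ∈ {w | h c ≤ h w ∧ p^[h w - h c] w = c} := ih (p' w) (by omega) hit (by omega)
    have huY : p' w ∉ Y := fun hmem => by
      have := (h0 (p' w)).2 hmem
      have := hu.1
      omega
    have hurt : p^[h (p' w)] (p' w) = y := by rw [iterate_parent_height_eq_of_mem_cone hu, hy]
    have hdu : G.dist y (p' w) = h (p' w) := dist_root_eq_height_of_mem_cone h0 hpar hdist hy hu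
    -- `w` is not the `Y`-parent of `u`
    have hne : w ≠ p (p' w) := by
      intro heq
      have hstep := dist_root_parent_succ h0 hpar hdist huY hurt
      rw [← heq] at hstep
      omega
    obtain ⟨hhw, hpw⟩ := hchild (p' w) w huY hadj.symm hne
    have hwc : w ≠ c := by
      rintro rfl
      have := hu.1
      omega
    refine (mem_cone_iff_parent_mem_cone h0 hpar hwc).2 ⟨?_, ?_⟩
    · have := hu.1
      omega
    · rw [hpw]
      exact hu

/-! ## §3 The dictionary: cone toward `Y` = rooted shadow from the gate; intersections, counts, children -/

include h0 hpar hchild in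
/-- **CONE TOWARD A SUBTREE = ROOTED SHADOW FROM ITS GATE.**  In a tree with retraction data `(h, p)` toward `Y`, for `c ∉ Y` with root `y = p^[h c] c`:
`{w | h c ≤ h w ∧ p^[h w − h c] w = c} = {w | dist(y, w) = dist(y, c) + dist(c, w)}` — the cone of `c` toward the subtree is the descendant set of `c` in the tree ROOTED
at the gate `y` (the currency of ★ `TreeDescendantPartition` §4 and of the ★ tree-induction engines). [cite: Serre1980Trees, I.2.3] [cite: Diestel2010, Thm. 1.5.1] -/
theorem cone_eq_setOf_dist_root (hT : G.IsTree) (hdist : ∀ v, (∃ y ∈ Y, G.dist v y = h v) ∧ ∀ y ∈ Y, h v ≤ G.dist v y)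
    {c y : V} (hcY : c ∉ Y) (hy : p^[h c] c = y) :
    {w | h c ≤ h w ∧ p^[h w - h c] w = c} = {w | G.dist y w = G.dist y c + G.dist c w} := by
  ext w
  exact ⟨fun hw => dist_root_eq_add_of_mem_cone h0 hpar hT.1 hdist hy hw, fun hw => mem_cone_of_dist_root_eq_add h0 hpar hchild hT hdist hcY hy hw⟩

include h0 hpar hchild in
/-- The `∩ S` spelling of `cone_eq_setOf_dist_root`. [cite: Serre1980Trees, I.2.3] -/
theorem cone_inter_eq_setOf_dist_root_inter (hT : G.IsTree) (hdist : ∀ v, (∃ y ∈ Y, G.dist v y = h v) ∧ ∀ y ∈ Y, h v ≤ G.dist v y)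
    {c y : V} (hcY : c ∉ Y) (hy : p^[h c] c = y) (S : Set V) :
    {w | h c ≤ h w ∧ p^[h w - h c] w = c} ∩ S = {w | G.dist y w = G.dist y c + G.dist c w} ∩ S := by
  rw [cone_eq_setOf_dist_root h0 hpar hchild hT hdist hcY hy]

include h0 hpar hchild in
/-- The counting spelling of `cone_eq_setOf_dist_root`: `#(Cone_Y(c) ∩ S) = #(Desc_y(c) ∩ S)`. [cite: Serre1980Trees, I.2.3] -/
theorem ncard_cone_inter_eq_ncard_setOf_dist_root_inter (hT : G.IsTree) (hdist : ∀ v, (∃ y ∈ Y, G.dist v y = h v) ∧ ∀ y ∈ Y, h v ≤ G.dist v y)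
    {c y : V} (hcY : c ∉ Y) (hy : p^[h c] c = y) (S : Set V) :
    ({w | h c ≤ h w ∧ p^[h w - h c] w = c} ∩ S).ncard = ({w | G.dist y w = G.dist y c + G.dist c w} ∩ S).ncard := by
  rw [cone_eq_setOf_dist_root h0 hpar hchild hT hdist hcY hy]

include h0 hpar hchild in
/-- **The cone of a DESCENDANT is its rooted shadow from the same gate**: for `v ∈ Cone_Y(c)` (`c ∉ Y`, root `y`),
`{w | h v ≤ h w ∧ p^[h w − h v] w = v} = {w | dist(y, w) = dist(y, v) + dist(v, w)}`. [cite: Serre1980Trees, I.2.3] -/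
theorem cone_eq_setOf_dist_root_of_mem_cone (hT : G.IsTree) (hdist : ∀ v, (∃ y ∈ Y, G.dist v y = h v) ∧ ∀ y ∈ Y, h v ≤ G.dist v y)
    {c y : V} (hcY : c ∉ Y) (hy : p^[h c] c = y) {v : V} (hv : v ∈ {w | h c ≤ h w ∧ p^[h w - h c] w = c}) :
    {w | h v ≤ h w ∧ p^[h w - h v] w = v} = {w | G.dist y w = G.dist y v + G.dist v w} := by
  have hvY : v ∉ Y := fun hmem => by
    have := (h0 v).2 hmem
    have := hv.1
    have : h c = 0 := by omega
    exact hcY ((h0 c).1 this)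
  have hvy : p^[h v] v = y := by rw [iterate_parent_height_eq_of_mem_cone hv, hy]
  exact cone_eq_setOf_dist_root h0 hpar hchild hT hdist hvY hvy

include h0 hpar hchild in
/-- **Children dictionary**: for a cone vertex `v` (toward `Y`, gate `y`) and a neighbour `c'` of `v`: `c'` is a child in the `(h, p)` sense iff it is a child in the tree
rooted at `y` — `h c' = h v + 1 ↔ dist(y, c') = dist(y, v) + 1`. [cite: Serre1980Trees, I.2.3] -/
theorem height_eq_succ_iff_dist_root_eq_succ_of_mem_cone (hdist : ∀ v, (∃ y ∈ Y, G.dist v y = h v) ∧ ∀ y ∈ Y, h v ≤ G.dist v y)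
    {c y : V} (hcY : c ∉ Y) (hy : p^[h c] c = y) {v c' : V} (hv : v ∈ {w | h c ≤ h w ∧ p^[h w - h c] w = c}) (hadj : G.Adj v c') :
    h c' = h v + 1 ↔ G.dist y c' = G.dist y v + 1 := by
  have hvY : v ∉ Y := fun hmem => by
    have := (h0 v).2 hmem
    have := hv.1
    have : h c = 0 := by omega
    exact hcY ((h0 c).1 this)
  have hvy : p^[h v] v = y := by rw [iterate_parent_height_eq_of_mem_cone hv, hy]
  have hdv : G.dist y v = h v := dist_root_eq_height_of_mem_cone h0 hpar hdist hy hv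
  by_cases hcp : c' = p v
  · -- the parent: one step closer in both senses
    subst hcp
    have hstep := dist_root_parent_succ h0 hpar hdist hvY hvy
    have hh := (hpar v hvY).2
    constructor <;> intro habs <;> omega
  · -- a child: one step further in both senses
    obtain ⟨hh, hpc⟩ := hchild v c' hvY hadj hcp
    have hc'cone : c' ∈ {w | h v ≤ h w ∧ p^[h w - h v] w = v} :=
      ⟨by omega, by rw [hh, Nat.add_sub_cancel_left, Function.iterate_one, hpc]⟩
    have hc'c : c' ∈ {w | h c ≤ h w ∧ p^[h w - h c] w = c} := cone_subset_cone_of_mem_cone hv hc'cone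
    have hdc : G.dist y c' = h c' := dist_root_eq_height_of_mem_cone h0 hpar hdist hy hc'c
    constructor <;> intro _ <;> omega

include h0 hpar in
/-- **Roots of fixed vertices are fixed** (equivariance, ★ `root_equivariant`, read pointwise): if a `Y`-preserving automorphism `φ` with (P4) fixes `c`, it fixes the
root of `c` — so the cones meeting the fixed set sit over FIXED vertices of `Y`, and the fixed set is parent-closed toward each such root (★ `parentClosed_fixedPoints`).
[cite: Serre1980Trees, I.6.4 Prop. 24] -/
theorem apply_iterate_parent_height_eq_of_apply_eq (φ : G ≃g G) (hequi : ∀ v, h (φ v) = h v ∧ (v ∉ Y → p (φ v) = φ (p v)))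
    {c : V} (hc : φ c = c) : φ (p^[h c] c) = p^[h c] c := by
  have key := root_equivariant h0 hpar φ hequi c
  rw [hc] at key
  exact key.symm

/-! ## §4 Counting over the roots: a finite set is counted cone by cone over the subtree -/

/-- **COUNTING CONE BY CONE OVER THE SUBTREE.**  For a finite `S ⊆ V` and any Finset `sY` containing the roots of the elements of `S` (membership characterisation `hsY`, engine
style): `#S = Σ_{y ∈ sY} #({w | p^[h w] w = y} ∩ S)` — the cones over `Y` partition `V` (★ `setOf_root_mem_eq_biUnion`, `disjoint_cone_of_ne`), read as a `Finset.sum`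
(`Finset.card_eq_sum_card_fiberwise` for the root map).  With `S` = the fixed self-dual vertices of a type-(2) literal and `sY` ⊇ its fixed axis vertices this is the count
«axis vertex by axis vertex» of the tube. [cite: Serre1980Trees, I.2.3] -/
theorem ncard_eq_sum_ncard_cone_inter [DecidableEq V] (S : Set V) (hS : S.Finite) (sY : Finset V) (hsY : ∀ w ∈ S, p^[h w] w ∈ sY) :
    S.ncard = ∑ y ∈ sY, ({w | p^[h w] w = y} ∩ S).ncard := by
  classical
  rw [Set.ncard_eq_toFinset_card S hS]
  rw [Finset.card_eq_sum_card_fiberwise (f := fun w => p^[h w] w) (t := sY) (fun w hw => hsY w ((Set.Finite.mem_toFinset hS).1 hw))]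
  refine Finset.sum_congr rfl fun y _ => ?_
  have hfin : ({w | p^[h w] w = y} ∩ S).Finite := hS.subset Set.inter_subset_right
  rw [Set.ncard_eq_toFinset_card _ hfin]
  congr 1
  ext w
  simp only [Finset.mem_filter, Set.Finite.mem_toFinset, Set.mem_inter_iff, Set.mem_setOf_eq]
  exact and_comm

/-- The same with a predicate: `#(S ∩ P) = Σ_{y ∈ sY} #({w | p^[h w] w = y} ∩ S ∩ P)`. [cite: Serre1980Trees, I.2.3] -/
theorem ncard_inter_eq_sum_ncard_cone_inter [DecidableEq V] (S : Set V) (hS : S.Finite) (P : Set V) (sY : Finset V) (hsY : ∀ w ∈ S, p^[h w] w ∈ sY) :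
    (S ∩ P).ncard = ∑ y ∈ sY, ({w | p^[h w] w = y} ∩ S ∩ P).ncard := by
  rw [ncard_eq_sum_ncard_cone_inter (h := h) (p := p) (S ∩ P) (hS.subset Set.inter_subset_left) sY (fun w hw => hsY w hw.1)]
  refine Finset.sum_congr rfl fun y _ => ?_
  rw [Set.inter_assoc]

/-! ## §5 (ED. 2) Any vertex of the subtree as root: the cone of `c` is the rooted shadow of `c` from EVERY `y′ ∈ Y` -/

include h0 hpar hchild in
/-- The `Y`-parent of `u ∉ Y` is one step closer to EVERY `y′ ∈ Y`: `dist(y′, p u) + 1 = dist(y′, u)` (the gate: geodesics into `Y` pass through the root).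
[cite: Serre1980Trees, I.2.3] -/
theorem dist_parent_succ_of_mem (hc : G.Connected) {u y' : V} (hu : u ∉ Y) (hy' : y' ∈ Y) : G.dist y' (p u) + 1 = G.dist y' u := by
  have hgu := dist_eq_height_add_dist_root h0 hpar hchild hc hy' u
  have hgp := dist_eq_height_add_dist_root h0 hpar hchild hc hy' (p u)
  rw [iterate_parent_height_parent hpar hu] at hgp
  have hh := (hpar u hu).2
  have e1 : G.dist y' (p u) = G.dist (p u) y' := SimpleGraph.dist_comm
  have e2 : G.dist y' u = G.dist u y' := SimpleGraph.dist_comm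
  omega

include h0 hpar hchild in
/-- **The cone lies in the rooted shadow from every `y′ ∈ Y`**: `w ∈ Cone_Y(c) ⇒ dist(y′, w) = dist(y′, c) + dist(c, w)` (`G` connected; the gate at `w` and at `c`, which
share their root). [cite: Serre1980Trees, I.2.3] -/
theorem dist_eq_add_of_mem_cone_of_mem (hc : G.Connected) (hdist : ∀ v, (∃ y ∈ Y, G.dist v y = h v) ∧ ∀ y ∈ Y, h v ≤ G.dist v y)
    {c w y' : V} (hy' : y' ∈ Y) (hw : w ∈ {w | h c ≤ h w ∧ p^[h w - h c] w = c}) : G.dist y' w = G.dist y' c + G.dist c w := by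
  have hgw := dist_eq_height_add_dist_root h0 hpar hchild hc hy' w
  have hgc := dist_eq_height_add_dist_root h0 hpar hchild hc hy' c
  rw [iterate_parent_height_eq_of_mem_cone hw] at hgw
  have h1 : h w = h c + G.dist c w := height_eq_add_dist_of_mem_cone h0 hpar hc hdist hw
  have e1 : G.dist y' w = G.dist w y' := SimpleGraph.dist_comm
  have e2 : G.dist y' c = G.dist c y' := SimpleGraph.dist_comm
  omega

include h0 hpar hchild in
/-- **The rooted shadow from any `y′ ∈ Y` consists of descendants**: in a tree, for `c ∉ Y`, `y′ ∈ Y` and `dist(y′, w) = dist(y′, c) + dist(c, w)`: `w ∈ Cone_Y(c)`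
(the induction of `mem_cone_of_dist_root_eq_add` along the rooted parent map at `y′`, with `dist_parent_succ_of_mem` in place of the root distances).
[cite: Serre1980Trees, I.2.3] [cite: Diestel2010, Thm. 1.5.1] -/
theorem mem_cone_of_dist_eq_add_of_mem (hT : G.IsTree)
    {c y' : V} (hcY : c ∉ Y) (hy' : y' ∈ Y) {w : V} (hw : G.dist y' w = G.dist y' c + G.dist c w) :
    w ∈ {w | h c ≤ h w ∧ p^[h w - h c] w = c} := by
  obtain ⟨p', hp'par, -, -, hp'cone⟩ := exists_rooted_parent hT y'
  suffices key : ∀ (k : ℕ) (w : V), G.dist y' c ≤ G.dist y' w → p'^[k] w = c → G.dist y' w - G.dist y' c = k →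
      w ∈ {w | h c ≤ h w ∧ p^[h w - h c] w = c} by
    obtain ⟨hle, hit⟩ := (hp'cone c w).1 hw
    exact key _ w hle hit rfl
  intro k
  induction k with
  | zero =>
    intro w _ hit _
    rw [Function.iterate_zero_apply] at hit
    rw [hit]
    exact mem_cone_self c
  | succ k ih =>
    intro w hle hit hk
    have hwy : w ≠ y' := by
      rintro rfl
      rw [SimpleGraph.dist_self] at hk
      omega
    obtain ⟨hadj, hdp⟩ := hp'par w hwy
    rw [Function.iterate_succ_apply] at hit
    have hu : p' w ∈ {w | h c ≤ h w ∧ p^[h w - h c] w = c} := ih (p' w) (by omega) hit (by omega)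
    have huY : p' w ∉ Y := fun hmem => by
      have := (h0 (p' w)).2 hmem
      have := hu.1
      have : h c = 0 := by omega
      exact hcY ((h0 c).1 this)
    -- `w` is not the `Y`-parent of `u := p' w`: that parent is one step CLOSER to `y'`, `w` one step farther
    have hne : w ≠ p (p' w) := by
      intro heq
      have hstep := dist_parent_succ_of_mem h0 hpar hchild hT.1 huY hy'
      rw [← heq] at hstep
      omega
    obtain ⟨hhw, hpw⟩ := hchild (p' w) w huY hadj.symm hne
    have hwc : w ≠ c := by
      rintro rfl
      have := hu.1
      omega
    refine (mem_cone_iff_parent_mem_cone h0 hpar hwc).2 ⟨?_, ?_⟩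
    · have := hu.1
      omega
    · rw [hpw]
      exact hu

include h0 hpar hchild in
/-- **CONE TOWARD A SUBTREE = ROOTED SHADOW FROM ANY VERTEX OF THE SUBTREE**: for `c ∉ Y` and every `y′ ∈ Y`,
`{w | h c ≤ h w ∧ p^[h w − h c] w = c} = {w | dist(y′, w) = dist(y′, c) + dist(c, w)}` — so the whole tube of a type-(2) literal can be read in the tree rooted ONCE at any
fixed axis vertex (e.g. the centre of the fixed axis ball), cone by cone. [cite: Serre1980Trees, I.2.3] [cite: Diestel2010, Thm. 1.5.1] -/
theorem cone_eq_setOf_dist_of_mem (hT : G.IsTree) (hdist : ∀ v, (∃ y ∈ Y, G.dist v y = h v) ∧ ∀ y ∈ Y, h v ≤ G.dist v y)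
    {c y' : V} (hcY : c ∉ Y) (hy' : y' ∈ Y) :
    {w | h c ≤ h w ∧ p^[h w - h c] w = c} = {w | G.dist y' w = G.dist y' c + G.dist c w} := by
  ext w
  exact ⟨fun hw => dist_eq_add_of_mem_cone_of_mem h0 hpar hchild hT.1 hdist hy' hw, fun hw => mem_cone_of_dist_eq_add_of_mem h0 hpar hchild hT hcY hy' hw⟩

include h0 hpar hchild in
/-- The counting spelling: `#(Cone_Y(c) ∩ S) = #({w | dist(y′, w) = dist(y′, c) + dist(c, w)} ∩ S)` for every `y′ ∈ Y`. [cite: Serre1980Trees, I.2.3] -/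
theorem ncard_cone_inter_eq_ncard_setOf_dist_inter_of_mem (hT : G.IsTree) (hdist : ∀ v, (∃ y ∈ Y, G.dist v y = h v) ∧ ∀ y ∈ Y, h v ≤ G.dist v y)
    {c y' : V} (hcY : c ∉ Y) (hy' : y' ∈ Y) (S : Set V) :
    ({w | h c ≤ h w ∧ p^[h w - h c] w = c} ∩ S).ncard = ({w | G.dist y' w = G.dist y' c + G.dist c w} ∩ S).ncard := by
  rw [cone_eq_setOf_dist_of_mem h0 hpar hchild hT hdist hcY hy']

include h0 hpar hchild in
/-- **Children dictionary from any `y′ ∈ Y`**: for a vertex `v ∉ Y` and a neighbour `c′`: `h c′ = h v + 1 ↔ dist(y′, c′) = dist(y′, v) + 1` — so the rooted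
grandchildren binder `GC` at `y′` of the ★ engines is the `(h, p)` one below the subtree. [cite: Serre1980Trees, I.2.3] -/
theorem height_eq_succ_iff_dist_eq_succ_of_mem (hc : G.Connected) {v c' y' : V} (hvY : v ∉ Y) (hy' : y' ∈ Y) (hadj : G.Adj v c') :
    h c' = h v + 1 ↔ G.dist y' c' = G.dist y' v + 1 := by
  by_cases hcp : c' = p v
  · subst hcp
    have hstep := dist_parent_succ_of_mem h0 hpar hchild hc hvY hy'
    have hh := (hpar v hvY).2
    constructor <;> intro habs <;> omega
  · obtain ⟨hh, hpc⟩ := hchild v c' hvY hadj hcp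
    have hc'Y : c' ∉ Y := fun hmem => by have := (h0 c').2 hmem; omega
    have hstep := dist_parent_succ_of_mem h0 hpar hchild hc hc'Y hy'
    rw [hpc] at hstep
    constructor <;> intro _ <;> omega

include h0 hpar hchild in
/-- **Parent dictionary from any `y′ ∈ Y`**: for `v ∉ Y` and a neighbour `u`: `u = p v ↔ dist(y′, u) + 1 = dist(y′, v)` — the rooted parent toward `y′` of a vertex
below the subtree is its `Y`-parent (so `F` parent-closed in the `(h, p)` sense is parent-closed toward `y′`, the `hF` of the ★ engines). [cite: Serre1980Trees, I.2.3] -/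
theorem eq_parent_iff_dist_succ_eq_of_mem (hc : G.Connected) {v u y' : V} (hvY : v ∉ Y) (hy' : y' ∈ Y) (hadj : G.Adj v u) :
    u = p v ↔ G.dist y' u + 1 = G.dist y' v := by
  have hstep := dist_parent_succ_of_mem h0 hpar hchild hc hvY hy'
  constructor
  · rintro rfl; exact hstep
  · intro hu
    by_contra hne
    obtain ⟨hh, hpc⟩ := hchild v u hvY hadj hne
    have huY : u ∉ Y := fun hmem => by have := (h0 u).2 hmem; omega
    have hstep' := dist_parent_succ_of_mem h0 hpar hchild hc huY hy'
    rw [hpc] at hstep'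
    omega

end ConeShadow

end Literature.Combinatorics.SimpleGraph.TreeLayers
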